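import Mathlib.GroupTheory.Perm.DomMulAct
import Mathlib.Analysis.SpecialFunctions.Exp
import Mathlib.Analysis.SpecialFunctions.Pow.Real
import Mathlib.Algebra.BigOperators.Fin
import Mathlib.Data.Fintype.Perm
import Literature.Barriers.MatrixMultiplication.YoungSubgroupBarrier
import Summits.MatrixMultiplication.MatrixMultiplication.Theses.SnSubsetDichotomy

/-!
# `GlobalBranch` (crux `stmt-MatrixMultiplication-8303`), negative side: planar Young triples
# and the umvirate pieces of a Young subgroup (hexagon witnesses, part 1 of 5)

Support file of the crux disprover (cdisprove seat) for route `SnSubsetDichotomy`.  The crux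
`GlobalBranch` bounds the volume of `(1/2+ε)`-bump-free TPP triples in `S_n` by
`(n!)^{3/2}e^{-c√n}`; its unconditional refutation would prove `ω(ℂ) = 2`
(`Negative/Resistance.lean`), so the disprover maps which STRENGTHENINGS fail.  The witnesses for
`Negative/SuperExp.lean` (super-exponential saving is false) and `Negative/Pairwise.lean` (the
two-set version is false) are the hexagon Young triples of Blasiak–Church–Cohn–Grochow–Umans
2017, §4; this file provides their two generic ingredients:

* `planar_core` — the planar identity: if `σ₂` preserves `b`, `σ₁` preserves `a` and `σ₁σ₂`
  preserves `c`, where `a + b + c` is constant and `(a, b)` determines the point, then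
  `σ₂ = σ₁ = 1`.  Proof: with `d = a ∘ σ₂ − a`, re-indexing sums over the bijections `σ₂` and
  `σ₁σ₂` gives `Σ d·b = Σ d·c = Σ d = 0`, hence `Σ d·a = 0` and `Σ d² = 0`.  Consequence
  (`Negative/Hexagon.lean`): ANY finite planar configuration gives a TPP triple of Young
  subgroups.
* `young f` (the Young subgroup `{σ | f ∘ σ = f}` as a `Finset`; `= {σ | σ ∈ youngSubgroup f}`),
  `card_young` (`|Y_f| = ∏ᵢ bᵢ!`, `DomMulAct.stabilizer_card`), `young_bump` — if all blocks have
  `≥ s` points then `|Y_f ∩ U_{I→L}|·(s/e)^t ≤ |Y_f|` for every injective `t`-tuple `I` (the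
  umvirate piece is a translate of the Young subgroup of the REFINED labelling `(f, tag I)`, whose
  order is `∏ᵢ (bᵢ − rᵢ)!`, and `(b/e)^r ≤ b^(r)` = `div_exp_pow_le_descFactorial`),
  `young_volume` (`(s/e)^n ≤ |Y_f|`).

No named facts are used; everything is unconditional.
-/

noncomputable section

set_option linter.dupNamespace false

open scoped BigOperators

namespace Summit.MatrixMultiplication.MatrixMultiplication.Theorems.GlobalBranch.Negative

open Equiv Literature.Combinatorics.Additive Literature.Barriers.MatrixMultiplication

/-! ## The planar identity -/



/-- Core of the planar argument: if `σ₂` preserves `b`, `σ₁` preserves `a`, `σ₁ ∘ σ₂` preserves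
`c`, where `a + b + c` is constant and `(a, b)` determines the point, then `σ₂ = 1` and `σ₁ = 1`. -/
theorem planar_core {P : Type*} [Fintype P] (a b c : P → ℤ) (k : ℤ) (hsum : ∀ p, a p + b p + c p = k)
    (hinj : ∀ p q, a p = a q → b p = b q → p = q) (σ₁ σ₂ : Equiv.Perm P)
    (h₁ : ∀ p, a (σ₁ p) = a p) (h₂ : ∀ p, b (σ₂ p) = b p) (h₃ : ∀ p, c (σ₁ (σ₂ p)) = c p) :
    σ₂ = 1 ∧ σ₁ = 1 := by
  -- `d p := a (σ₂ p) - a p`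
  set d : P → ℤ := fun p => a (σ₂ p) - a p with hd
  have hS0 : ∑ p, a (σ₂ p) = ∑ p, a p := Equiv.sum_comp σ₂ a
  have hSd : ∑ p, d p = 0 := by
    simp only [hd, Finset.sum_sub_distrib, hS0, sub_self]
  -- (i) `Σ d·b = 0`
  have hi : ∑ p, d p * b p = 0 := by
    have h := Equiv.sum_comp σ₂ (fun p => a p * b p)
    simp only [h₂] at h
    simp only [hd, sub_mul, Finset.sum_sub_distrib, h, sub_self]
  -- (ii) `Σ d·c = 0`
  have hii : ∑ p, d p * c p = 0 := by
    have h := Equiv.sum_comp (σ₂.trans σ₁) (fun p => a p * c p)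
    simp only [Equiv.trans_apply, h₃, h₁] at h
    simp only [hd, sub_mul, Finset.sum_sub_distrib, h, sub_self]
  -- (iii) `Σ a(σ₂ p)² = Σ a²`
  have hiii : ∑ p, a (σ₂ p) ^ 2 = ∑ p, a p ^ 2 := Equiv.sum_comp σ₂ (fun p => a p ^ 2)
  -- (iv) `Σ d·a = 0` from `a = k - b - c`
  have hiv : ∑ p, d p * a p = 0 := by
    have : ∀ p, d p * a p = k * d p - d p * b p - d p * c p := fun p => by
      rw [← hsum p]; ring
    simp only [this, Finset.sum_sub_distrib, ← Finset.mul_sum, hSd, hi, hii, mul_zero, sub_self]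
  -- hence `Σ d² = 0`
  have hd2 : ∑ p, d p ^ 2 = 0 := by
    have : ∀ p, a (σ₂ p) ^ 2 = a p ^ 2 + 2 * (d p * a p) + d p ^ 2 := fun p => by
      simp only [hd]; ring
    simp only [this, Finset.sum_add_distrib, ← Finset.mul_sum, hiv] at hiii
    linarith
  have hd0 : ∀ p, d p = 0 := by
    intro p
    have h := (Finset.sum_eq_zero_iff_of_nonneg (fun q _ => sq_nonneg (d q))).1 hd2 p
      (Finset.mem_univ _)
    exact pow_eq_zero_iff (n := 2) (by norm_num) |>.1 h
  -- so `σ₂` preserves `a` and `b`, hence is the identity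
  have hσ₂ : σ₂ = 1 := by
    ext p
    have ha : a (σ₂ p) = a p := by have := hd0 p; simp only [hd] at this; linarith
    simpa using hinj _ _ ha (h₂ p)
  refine ⟨hσ₂, ?_⟩
  ext p
  have hc : c (σ₁ p) = c p := by simpa [hσ₂] using h₃ p
  have hb : b (σ₁ p) = b p := by
    have := hsum (σ₁ p); have := hsum p; have := h₁ p; linarith
  simpa using hinj _ _ (h₁ p) hb


/-! ## Young subgroups and their umvirate pieces -/

variable {n : ℕ} {ι : Type*} [DecidableEq ι]

/-- The Young subgroup of a labelling, as a `Finset` of permutations. -/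
def young (f : Fin n → ι) : Finset (Perm (Fin n)) :=
  Finset.univ.filter (fun g => ∀ x, f (g x) = f x)

/-- Membership in `young f`: the permutation preserves the labelling. [folklore] -/
@[simp] theorem mem_young {f : Fin n → ι} {g : Perm (Fin n)} :
    g ∈ young f ↔ ∀ x, f (g x) = f x := by
  simp [young]

/-- `|Y_f| = ∏ᵢ |f⁻¹(i)|!`. -/
theorem card_young [Fintype ι] (f : Fin n → ι) :
    (young f).card = ∏ i, (Fintype.card {x // f x = i}).factorial := by
  rw [← DomMulAct.stabilizer_card f, young, ← Fintype.card_subtype]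
  refine Fintype.card_congr (Equiv.subtypeEquivRight fun g => ?_)
  simp [funext_iff]

section Refine

variable {t : ℕ} (f : Fin n → ι) (I : Fin t → Fin n)

/-- Tag singling out the points of `range I`: `x ↦ x+1` on `range I`, `0` elsewhere. -/
def tag (x : Fin n) : Fin (n + 1) := if ∃ k, I k = x then x.succ else 0

/-- The refined labelling: `f` together with the tag of `I`. -/
def refined (x : Fin n) : ι × Fin (n + 1) := (f x, tag I x)

/-- The tag vanishes exactly off `range I`. [folklore] -/
theorem tag_eq_zero_iff (x : Fin n) : tag I x = 0 ↔ ∀ k, I k ≠ x := by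
  unfold tag
  split_ifs with h
  · simp only [Fin.succ_ne_zero, false_iff, not_forall, not_not]; exact h
  · simp only [true_iff]; exact fun k hk => h ⟨k, hk⟩

/-- The tag of a source point `I k` is `(I k) + 1`. [folklore] -/
theorem tag_apply (k : Fin t) : tag I (I k) = (I k).succ := by
  unfold tag; rw [if_pos ⟨k, rfl⟩]

omit [DecidableEq ι] in
/-- Preserving the refined labelling = preserving `f` and fixing `range I` pointwise. -/
theorem forall_refined_iff (h : Perm (Fin n)) :
    (∀ x, refined f I (h x) = refined f I x) ↔ (∀ x, f (h x) = f x) ∧ ∀ k, h (I k) = I k := by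
  constructor
  · intro H
    refine ⟨fun x => (Prod.ext_iff.1 (H x)).1, fun k => ?_⟩
    have h2 : tag I (h (I k)) = tag I (I k) := (Prod.ext_iff.1 (H (I k))).2
    rw [tag_apply] at h2
    unfold tag at h2
    split_ifs at h2 with hx
    · exact Fin.succ_injective _ h2
    · exact absurd h2 (Fin.succ_ne_zero _).symm
  · rintro ⟨Hf, HI⟩ x
    refine Prod.ext (Hf x) ?_
    show tag I (h x) = tag I x
    by_cases hx : ∃ k, I k = x
    · obtain ⟨k, rfl⟩ := hx
      rw [HI k]
    · have hx' : ∀ k, I k ≠ x := fun k hk => hx ⟨k, hk⟩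
      have hhx : ∀ k, I k ≠ h x := by
        intro k hk
        apply hx' k
        apply h.injective
        rw [HI k, hk]
      rw [(tag_eq_zero_iff I x).2 hx', (tag_eq_zero_iff I (h x)).2 hhx]

/-- **Translate:** a non-empty umvirate piece of `Y_f` has the cardinality of the refined Young
subgroup. -/
theorem card_young_filter_eq {L : Fin t → Fin n} {σ₀ : Perm (Fin n)} (hσ₀ : σ₀ ∈ young f)
    (hσ₀L : ∀ k, σ₀ (I k) = L k) :
    ((young f).filter (fun g => ∀ k, g (I k) = L k)).card = (young (refined f I)).card := by
  rw [mem_young] at hσ₀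
  refine Finset.card_nbij' (fun g => σ₀⁻¹ * g) (fun h => σ₀ * h) ?_ ?_ ?_ ?_
  · intro g hg
    rw [Finset.coe_filter, Set.mem_setOf_eq, mem_young] at hg
    rw [Finset.mem_coe, mem_young, forall_refined_iff]
    refine ⟨fun x => ?_, fun k => ?_⟩
    · rw [Perm.mul_apply]
      have := hσ₀ (σ₀⁻¹ (g x))
      simp only [Perm.coe_inv, Equiv.apply_symm_apply] at this
      rw [Perm.coe_inv, ← this, hg.1 x]
    · rw [Perm.mul_apply, hg.2 k, ← hσ₀L k]
      simp
  · intro h hh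
    rw [Finset.mem_coe, mem_young, forall_refined_iff] at hh
    rw [Finset.coe_filter, Set.mem_setOf_eq, mem_young]
    refine ⟨fun x => ?_, fun k => ?_⟩
    · rw [Perm.mul_apply, hσ₀, hh.1]
    · rw [Perm.mul_apply, hh.2 k, hσ₀L k]
  · intro g _; simp [← mul_assoc]
  · intro g _; simp [← mul_assoc]

/-- Fibres of the refined labelling over a non-zero tag have at most one point. -/
theorem card_fibre_refined_succ_le (i : ι) (j : Fin n) :
    Fintype.card {x // refined f I x = (i, j.succ)} ≤ 1 := by
  refine Fintype.card_le_one_iff_subsingleton.2 ⟨fun x y => ?_⟩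
  obtain ⟨x, hx⟩ := x; obtain ⟨y, hy⟩ := y
  have hx2 : tag I x = j.succ := (Prod.ext_iff.1 hx).2
  have hy2 : tag I y = j.succ := (Prod.ext_iff.1 hy).2
  unfold tag at hx2 hy2
  split_ifs at hx2 hy2 with h1 h2 h2
  · exact Subtype.ext (Fin.succ_injective _ (hx2.trans hy2.symm))
  · exact absurd hy2.symm (Fin.succ_ne_zero _)
  · exact absurd hx2.symm (Fin.succ_ne_zero _)
  · exact absurd hx2.symm (Fin.succ_ne_zero _)

/-- The number of source points `I k` in block `i`. -/
def blockHits (i : ι) : ℕ :=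
  ((Finset.univ.filter (fun x : Fin n => f x = i)).filter (fun x => ¬ ∀ k, I k ≠ x)).card

/-- Fibre of the refined labelling over tag `0` = block minus the source points. -/
theorem card_fibre_refined_zero (i : ι) :
    Fintype.card {x // refined f I x = (i, 0)} + blockHits f I i = Fintype.card {x // f x = i} := by
  rw [Fintype.card_subtype, Fintype.card_subtype, blockHits]
  have hsplit :
      ((Finset.univ.filter (fun x : Fin n => f x = i)).filter (fun x => ∀ k, I k ≠ x)).card +
        ((Finset.univ.filter (fun x : Fin n => f x = i)).filter (fun x => ¬ ∀ k, I k ≠ x)).card =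
        (Finset.univ.filter (fun x : Fin n => f x = i)).card :=
    Finset.card_filter_add_card_filter_not _
  have hA : (Finset.univ.filter (fun x => refined f I x = (i, 0))) =
      (Finset.univ.filter (fun x : Fin n => f x = i)).filter (fun x => ∀ k, I k ≠ x) := by
    ext x
    simp only [Finset.mem_filter, Finset.mem_univ, true_and, refined, Prod.ext_iff,
      tag_eq_zero_iff]
  rw [hA]
  exact hsplit

/-- A block receives at most as many source points as it has points. [folklore] -/
theorem blockHits_le (i : ι) : blockHits f I i ≤ Fintype.card {x // f x = i} := by
  have := card_fibre_refined_zero f I i; omega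

/-- Every source point lies in exactly one block: `Σᵢ rᵢ = t`. [folklore] -/
theorem sum_blockHits [Fintype ι] (hI : Function.Injective I) : ∑ i, blockHits f I i = t := by
  unfold blockHits
  have h := Finset.card_eq_sum_card_fiberwise (f := f)
    (s := (Finset.univ : Finset (Fin n)).filter (fun x => ¬ ∀ k, I k ≠ x)) (t := Finset.univ)
    (fun _ _ => Finset.mem_univ _)
  have hR : ((Finset.univ : Finset (Fin n)).filter (fun x => ¬ ∀ k, I k ≠ x)).card = t := by
    have : (Finset.univ : Finset (Fin n)).filter (fun x => ¬ ∀ k, I k ≠ x) =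
        Finset.univ.image I := by
      ext x
      simp only [Finset.mem_filter, Finset.mem_univ, true_and, not_forall, not_not,
        Finset.mem_image]
    rw [this, Finset.card_image_of_injective _ hI, Finset.card_univ, Fintype.card_fin]
  rw [hR] at h
  refine Eq.trans (Finset.sum_congr rfl fun i _ => ?_) h.symm
  rw [Finset.filter_filter, Finset.filter_filter]
  congr 1
  exact Finset.filter_congr fun x _ => and_comm

/-- `|Y_{refined}| = ∏ᵢ (bᵢ - rᵢ)!`. -/
theorem card_young_refined [Fintype ι] :
    (young (refined f I)).card =
      ∏ i, (Fintype.card {x // f x = i} - blockHits f I i).factorial := by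
  rw [card_young, Fintype.prod_prod_type]
  refine Finset.prod_congr rfl fun i _ => ?_
  rw [Fin.prod_univ_succ]
  have h1 : ∏ j : Fin n, (Fintype.card {x // refined f I x = (i, j.succ)}).factorial = 1 := by
    refine Finset.prod_eq_one fun j _ => ?_
    exact Nat.factorial_eq_one.2 (card_fibre_refined_succ_le f I i j)
  rw [h1, mul_one]
  congr 1
  have := card_fibre_refined_zero f I i
  omega

end Refine

/-! ### The analytic bound `(b/e)^r ≤ b^(r)` -/

/-- `(b+1)^r ≤ e · b^r` for `r ≤ b` (from `(1 + 1/b)^b ≤ e`). [folklore] -/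
theorem pow_succ_le_exp_mul_pow (b r : ℕ) (hr : r ≤ b) :
    ((b : ℝ) + 1) ^ r ≤ Real.exp 1 * (b : ℝ) ^ r := by
  rcases Nat.eq_zero_or_pos b with rfl | hb
  · have : r = 0 := by omega
    subst this
    simp
  have hb' : (0 : ℝ) < b := by exact_mod_cast hb
  -- `(1 + 1/b)^r ≤ (1 + 1/b)^b ≤ exp(1/b)^b = e`
  have hge1 : (1 : ℝ) ≤ 1 + 1 / (b : ℝ) := by
    have : (0 : ℝ) ≤ 1 / (b : ℝ) := by positivity
    linarith
  have h1 : (1 + 1 / (b : ℝ)) ^ r ≤ Real.exp 1 := by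
    calc (1 + 1 / (b : ℝ)) ^ r ≤ (1 + 1 / (b : ℝ)) ^ b := pow_le_pow_right₀ hge1 hr
      _ ≤ (Real.exp (1 / (b : ℝ))) ^ b := by
          apply pow_le_pow_left₀ (by positivity)
          have := Real.add_one_le_exp (1 / (b : ℝ)); linarith
      _ = Real.exp 1 := by rw [← Real.exp_nat_mul]; congr 1; field_simp
  have h2 : ((b : ℝ) + 1) ^ r = (b : ℝ) ^ r * (1 + 1 / (b : ℝ)) ^ r := by
    rw [← mul_pow]; congr 1; field_simp
  rw [h2, mul_comm (Real.exp 1)]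
  exact mul_le_mul_of_nonneg_left h1 (by positivity)

/-- `b^r ≤ e^r · b^(r)` for `r ≤ b`, i.e. `(b/e)^r ≤ b!/(b-r)!`. -/
theorem pow_le_exp_mul_descFactorial : ∀ (b r : ℕ), r ≤ b →
    ((b : ℝ)) ^ r ≤ Real.exp 1 ^ r * (b.descFactorial r : ℝ)
  | 0, r, hr => by
      have : r = 0 := by omega
      subst this; simp
  | b + 1, 0, _ => by simp
  | b + 1, r + 1, hr => by
      have ih := pow_le_exp_mul_descFactorial b r (by omega)
      rw [Nat.succ_descFactorial_succ, Nat.cast_mul, pow_succ, pow_succ]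
      push_cast
      have h1 := pow_succ_le_exp_mul_pow b r (by omega)
      have hb1 : (0 : ℝ) ≤ (b : ℝ) + 1 := by positivity
      calc ((b : ℝ) + 1) ^ r * ((b : ℝ) + 1) ≤ (Real.exp 1 * (b : ℝ) ^ r) * ((b : ℝ) + 1) :=
            mul_le_mul_of_nonneg_right h1 hb1
        _ ≤ (Real.exp 1 * (Real.exp 1 ^ r * (b.descFactorial r : ℝ))) * ((b : ℝ) + 1) :=
            mul_le_mul_of_nonneg_right (mul_le_mul_of_nonneg_left ih (Real.exp_nonneg _)) hb1
        _ = Real.exp 1 ^ r * Real.exp 1 * (((b : ℝ) + 1) * (b.descFactorial r : ℝ)) := by ring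

/-- `(s/e)^r ≤ b^(r)` whenever `s ≤ b` and `r ≤ b`. -/
theorem div_exp_pow_le_descFactorial {s b r : ℕ} (hsb : s ≤ b) (hr : r ≤ b) :
    ((s : ℝ) / Real.exp 1) ^ r ≤ (b.descFactorial r : ℝ) := by
  have h := pow_le_exp_mul_descFactorial b r hr
  have he : (0 : ℝ) < Real.exp 1 ^ r := pow_pos (Real.exp_pos _) _
  rw [div_pow, div_le_iff₀ he]
  calc (s : ℝ) ^ r ≤ (b : ℝ) ^ r := pow_le_pow_left₀ (Nat.cast_nonneg _) (by exact_mod_cast hsb) r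
    _ ≤ Real.exp 1 ^ r * (b.descFactorial r : ℝ) := h
    _ = (b.descFactorial r : ℝ) * Real.exp 1 ^ r := mul_comm _ _

/-! ### The Young bump bound and the Young volume bound -/

/-- **Young bump bound.** If every block of `f` has at least `s` points then for injective
`I : Fin t → Fin n` and any `L`: `|Y_f ∩ U_{I→L}| · (s/e)^t ≤ |Y_f|`. -/
theorem young_bump [Fintype ι] {s : ℕ} (f : Fin n → ι)
    (hs : ∀ i, s ≤ Fintype.card {x // f x = i})
    {t : ℕ} (I L : Fin t → Fin n) (hI : Function.Injective I) :
    (((young f).filter (fun g => ∀ k, g (I k) = L k)).card : ℝ) * ((s : ℝ) / Real.exp 1) ^ t ≤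
      (young f).card := by
  rcases ((young f).filter (fun g => ∀ k, g (I k) = L k)).eq_empty_or_nonempty with h0 | ⟨σ₀, hσ₀⟩
  · rw [h0]; simp
  rw [Finset.mem_filter] at hσ₀
  rw [card_young_filter_eq f I hσ₀.1 hσ₀.2, card_young_refined f I, card_young f]
  -- `∏ (bᵢ - rᵢ)! · (s/e)^{Σ rᵢ} ≤ ∏ bᵢ! = ∏ (bᵢ-rᵢ)! bᵢ^(rᵢ)`
  have ht : ((s : ℝ) / Real.exp 1) ^ t = ∏ i, ((s : ℝ) / Real.exp 1) ^ blockHits f I i := by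
    rw [Finset.prod_pow_eq_pow_sum, sum_blockHits f I hI]
  rw [ht, Nat.cast_prod, Nat.cast_prod, ← Finset.prod_mul_distrib]
  refine Finset.prod_le_prod (fun i _ => by positivity) fun i _ => ?_
  have hr := blockHits_le f I i
  rw [← Nat.factorial_mul_descFactorial hr, Nat.cast_mul]
  exact mul_le_mul_of_nonneg_left (div_exp_pow_le_descFactorial (hs i) hr) (Nat.cast_nonneg _)

/-- **Young volume bound.** If every block of `f` has at least `s` points then
`(s/e)^n ≤ |Y_f|`. -/
theorem young_volume [Fintype ι] {s : ℕ} (f : Fin n → ι)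
    (hs : ∀ i, s ≤ Fintype.card {x // f x = i}) :
    ((s : ℝ) / Real.exp 1) ^ n ≤ (young f).card := by
  rw [card_young f, Nat.cast_prod]
  have hn : ∑ i, Fintype.card {x // f x = i} = n := by
    rw [← Fintype.card_sigma, Fintype.card_congr (Equiv.sigmaFiberEquiv f), Fintype.card_fin]
  have hpow : ((s : ℝ) / Real.exp 1) ^ n = ∏ i, ((s : ℝ) / Real.exp 1) ^ Fintype.card {x // f x = i} := by
    rw [Finset.prod_pow_eq_pow_sum, hn]
  rw [hpow]
  refine Finset.prod_le_prod (fun i _ => by positivity) fun i _ => ?_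
  have h := div_exp_pow_le_descFactorial (hs i) le_rfl
  rwa [Nat.descFactorial_self] at h



end Summit.MatrixMultiplication.MatrixMultiplication.Theorems.GlobalBranch.Negative
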